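import Literature.Analysis.FluidPDE.FractionalNSPrescribedEnergy
import HarnessLib

/-!
# Prescribed-energy Hölder solutions for families of energy profiles
# (Colombo–De Lellis–De Rosa 2018, Prop. 2.2)

Analysis/FluidPDE facts file, sibling of `FractionalNSPrescribedEnergy.lean` (which vendors the
later `1/3`-scheme, De Rosa 2019, Thm. 2.1). The non-uniqueness theorem of Colombo–De Lellis–De Rosa
for Leray solutions of `∂ₜv + div(v⊗v) + ∇p + (-Δ)^α v = 0` on `𝕋³` with `α < 1/5` (their Thm. 1.3,
the named fact `Literature.Barriers.NavierStokesRegularity.ColomboDeLellisDeRosa2018_thm13`) is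
proved in the source (§2, p. 5 of the held arXiv text: "Proposition 2.2 easily implies
Theorem 1.3") from exactly two ingredients:

* **Prop. 2.2** (`ColomboDeLellisDeRosa2018_prop22`, this file) — the output of the
  convex-integration scheme of §§3–8 (Prop. 3.2, after Buckmaster–De Lellis–Isett–Székelyhidi) run
  "universally" over a family `𝓔` of smooth energy profiles with common `e(0)` and `e'(0)`: for
  each `e ∈ 𝓔` a continuous distributional solution `v_e` on `𝕋³ × [0,1]` with
  `∫|v_e|²(x,t) dx = e(t)`, all with the same initial datum, and — for `α < α + ε < 1/5`, `ε`
  small — the explicit Hölder bound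
  `‖v_e‖_{C^{α+ε}} ≤ C(α,ε) max{E₁^{2α+3ε}, E₂^{(2α+4ε)/3}}` in terms of the uniform `C¹` and
  `C²` bounds `E₁, E₂` of the family. This is the research-level core (a theory, not a lemma); it
  stays a named fact.
* **Cor. 11.2** — `∫|(-Δ)^{α/2} f|² ≤ C(ε) [f]²_{α+ε}`; verbatim De Rosa 2019, Cor. 7.2, which the
  tree has PROVED (`DeRosa2019_cor72_holds` in `FractionalNSPrescribedEnergyProofs`).

The assembly "Prop. 2.2 + Cor. 11.2 ⇒ Thm. 1.3" is carried out in
`Literature/Barriers/NavierStokesRegularity/HypodissipativeLerayNonuniquenessProofs`.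

## Normalisation

Exactly as in `FractionalNSPrescribedEnergy` (read its header): the tree's torus is the unit torus
`(ℝ/ℤ)³` with probability measure and symbol `(2π|k|)^{2α}`, the source prints the `2π`-periodic
torus with symbol `|k|^{2α}` on the time interval `[0,1]`. A printed solution `v` corresponds to
the tree solution `u(y,s) = λ v(2πy, μs)` with `λ = (2π)^{2α-1}`, `μ = (2π)^{2α}`; under this
dictionary the time interval becomes `[0,T₀]`, `T₀ = μ⁻¹`, energies are multiplied by
`c₀ = λ²(2π)⁻³`, first (second) time derivatives of profiles by `c₀/T₀` (`c₀/T₀²`), and spatial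
Hölder norms by at most `λ(2π)^β`. `ColomboDeLellisDeRosa2018_prop22` therefore quantifies
`∃ c₀ T₀ > 0` and states the hypotheses on the window `[0,T₀]` with values in `[c₀/2, c₀]`; with
`c₀ = T₀ = 1` it is literally the printed normalisation.

## What is (not) transcribed

* Hypotheses (iv)–(v) are printed as `sup_{e∈𝓔} ‖e‖_{C¹} = E₁`, `sup_{e∈𝓔} ‖e‖_{C²} = E₂` with
  `E₁, E₂ > 1`. The proof (§8.3: "it suffices to notice that we just need to replace the `‖e‖_{C¹}`
  and `‖e‖_{C²}` in (36) with `E₁` and `E₂`", i.e. in the lower bounds for the parameter `a` of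
  Prop. 3.2) uses them only as UPPER BOUNDS, and the conclusion (c) is monotone in `E₁, E₂`. We
  transcribe them as bounds on the derivatives, `|e'| ≤ c₀E₁/T₀`, `|e''| ≤ c₀E₂/T₀²` on `[0,T₀]`,
  for parameters `1 < E₁ ≤ E₂` (`IsEnergyProfileFamily`): a printed profile then has
  `‖e‖_{C¹} ≤ 1 + E₁ ≤ 2E₁` and `‖e‖_{C²} ≤ 1 + E₁ + E₂ ≤ 3E₂`, and the factors `2^{2α+3ε}`,
  `3^{(2α+4ε)/3}` are absorbed into `C(α,ε)`. Profiles are smooth on `ℝ` (printed: smooth on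
  `[0,1]`; restricting the hypothesis class weakens the fact).
* Only the case `α < 1/5` together with conclusion (c) is transcribed (Prop. 2.2 (a), (b), (d) are
  printed for every `α ∈ ]0, 1/2[`); the order of quantifiers is "for `α` there is `ε₀(α)`; for
  `0 < ε ≤ ε₀` with `α + ε < 1/5` there are `c₀, T₀, C`" (printed: `C = C(α,ε)`, window constants
  depending on `α` only — letting them depend on `ε` as well is weaker).
* "(a) `(v_e, p_e)` solves (NS)": the pair of Thm. 2.1 is in `C⁰(𝕋³ × [0,1]; ℝ³ × ℝ)`; transcribed
  as continuity of `v_e` on the closed slab plus the tree's pressure-free distributional notion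
  `Torus.IsWeakFracNSSolutionOn T₀ α 1` (divergence-free tests supported in `(0,T₀)`; implied by
  the printed notion, the pressure dropping out). The pressure and its `C^{2ϑ}` regularity
  (Thm. 2.1 (i)) are not transcribed.
* "(c) `‖v_e‖_{C^{α+ε}} ≤ …`" is the space–time Hölder norm (proof of Thm. 2.1: "`‖·‖_{C^ϑ}` for
  Hölder norms in space and time"; §10: `‖f‖_ϑ = ‖f‖₀ + [f]_ϑ`); transcribed SLICE-WISE through
  `FunctionSpaces.eBoundedHolderNorm ϑ (v e t) = ‖v e t‖_∞ + [v e t]_ϑ` for every `t ∈ [0,T₀]`,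
  which the printed bound implies (weaker) and which is what the proof of Thm. 1.3 consumes.
* "(d) the initial data `v_e(·,0)` is the same for every `e ∈ 𝓔`" refers to the solution ASSIGNED
  to a profile by the construction; transcribed by an existentially quantified solution map
  `v : (ℝ → ℝ) → (ℝ → 𝕋³ → ℝ³)` constrained on `𝓔`.

## References

* M. Colombo, C. De Lellis, L. De Rosa, *Ill-posedness of Leray solutions for the hypodissipative
  Navier–Stokes equations*, Comm. Math. Phys. 362 (2018), 659–688 (held: arXiv:1708.05666): §2
  Thm. 2.1, Prop. 2.2 and the proof of Thm. 1.3 (p. 5); §3 Prop. 3.2 (p. 7); §8.3 (proof of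
  Prop. 2.2, pp. 18–19); §10 (Hölder norms, p. 21). [`ColomboDelellisDerosa2018`]
* L. De Rosa, Comm. PDE 44 (2019), 335–365 (held: arXiv:1801.10235), §2 Thm. 2.1 (the `1/3`
  analogue, `DeRosa2019_thm21`). [`Derosa2018`]
* T. Buckmaster, C. De Lellis, P. Isett, L. Székelyhidi Jr., Ann. of Math. 182 (2015) (the scheme
  adapted in Prop. 3.2). [`BuckmasterEtAl2015`]
-/

noncomputable section

open MeasureTheory Set Filter Function
open scoped ENNReal NNReal ContDiff

namespace Literature.Analysis.FluidPDE

section NS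

local notation "𝕋³" => UnitAddTorus (Fin 3)
local notation "ℝ³" => EuclideanSpace ℝ (Fin 3)

/-! ## Admissible families of energy profiles -/

/-- **Admissible families of energy profiles** (hypotheses (i)–(v) of Colombo–De Lellis–De Rosa
2018, Prop. 2.2, in the normalised window of this file; see the header for (iv)–(v)): a set `𝓔`
of smooth `e : ℝ → ℝ` with (i) `c₀/2 ≤ e ≤ c₀` on `[0,T₀]`, (ii) common value `e(0)`,
(iii) common slope `e'(0)`, (iv) `|e'| ≤ c₀E₁/T₀` and (v) `|e''| ≤ c₀E₂/T₀²` on `[0,T₀]`. For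
`c₀ = T₀ = 1` these are the printed "(i) `½ ≤ e(t) ≤ 1` for every `t` and every `e ∈ 𝓔`;
(ii) `e(0)` is the same for every `e ∈ 𝓔`; (iii) `e'(0)` is the same for every `e ∈ 𝓔`;
(iv) `sup_{e∈𝓔} ‖e‖_{C¹} = E₁`; (v) `sup_{e∈𝓔} ‖e‖_{C²} = E₂`" with the `C^k` norms read as
bounds on the derivatives. [cite: ColomboDelellisDerosa2018, §2 Prop. 2.2 (i)–(v)] -/
structure IsEnergyProfileFamily (c₀ T₀ E₁ E₂ : ℝ) (𝓔 : Set (ℝ → ℝ)) : Prop where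
  /-- Every profile is smooth on `ℝ`. -/
  contDiff : ∀ e ∈ 𝓔, ContDiff ℝ ∞ e
  /-- (i) lower bound `c₀/2 ≤ e` on `[0, T₀]` (printed: `½ ≤ e`). -/
  lower : ∀ e ∈ 𝓔, ∀ t ∈ Icc 0 T₀, c₀ / 2 ≤ e t
  /-- (i) upper bound `e ≤ c₀` on `[0, T₀]` (printed: `e ≤ 1`). -/
  upper : ∀ e ∈ 𝓔, ∀ t ∈ Icc 0 T₀, e t ≤ c₀
  /-- (ii) the value at `t = 0` is common to the family. -/
  apply_zero_eq : ∀ e₁ ∈ 𝓔, ∀ e₂ ∈ 𝓔, e₁ 0 = e₂ 0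
  /-- (iii) the slope at `t = 0` is common to the family. -/
  deriv_zero_eq : ∀ e₁ ∈ 𝓔, ∀ e₂ ∈ 𝓔, deriv e₁ 0 = deriv e₂ 0
  /-- (iv) uniform slope bound `|e'| ≤ c₀ E₁ / T₀` on `[0, T₀]` (printed: `‖e‖_{C¹} ≤ E₁`). -/
  abs_deriv_le : ∀ e ∈ 𝓔, ∀ t ∈ Icc 0 T₀, |deriv e t| ≤ c₀ * E₁ / T₀
  /-- (v) uniform curvature bound `|e''| ≤ c₀ E₂ / T₀²` on `[0, T₀]` (printed: `‖e‖_{C²} ≤ E₂`). -/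
  abs_iteratedDeriv_two_le : ∀ e ∈ 𝓔, ∀ t ∈ Icc 0 T₀, |iteratedDeriv 2 e t| ≤ c₀ * E₂ / T₀ ^ 2

/-- The one-element family `{t ↦ c₀}` is admissible for all `c₀, E₁, E₂ ≥ 0`, `T₀ ≥ 0`
(non-vacuity of `IsEnergyProfileFamily`). [folklore] -/
theorem isEnergyProfileFamily_singleton_const {c₀ T₀ E₁ E₂ : ℝ} (hc₀ : 0 ≤ c₀) (hT₀ : 0 ≤ T₀)
    (hE₁ : 0 ≤ E₁) (hE₂ : 0 ≤ E₂) :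
    IsEnergyProfileFamily c₀ T₀ E₁ E₂ {fun _ => c₀} where
  contDiff := fun e he => by
    rw [mem_singleton_iff.1 he]
    exact contDiff_const
  lower := fun e he _ _ => by
    rw [mem_singleton_iff.1 he]
    linarith
  upper := fun e he _ _ => by
    rw [mem_singleton_iff.1 he]
  apply_zero_eq := fun e₁ he₁ e₂ he₂ => by
    rw [mem_singleton_iff.1 he₁, mem_singleton_iff.1 he₂]
  deriv_zero_eq := fun e₁ he₁ e₂ he₂ => by
    rw [mem_singleton_iff.1 he₁, mem_singleton_iff.1 he₂]
  abs_deriv_le := fun e he _ _ => by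
    rw [mem_singleton_iff.1 he, deriv_const', abs_zero]
    positivity
  abs_iteratedDeriv_two_le := fun e he _ _ => by
    rw [mem_singleton_iff.1 he, iteratedDeriv_const]
    simp only [OfNat.ofNat_ne_zero, if_false, abs_zero]
    positivity

/-- Admissibility of a family passes to subfamilies. [folklore] -/
theorem IsEnergyProfileFamily.mono {c₀ T₀ E₁ E₂ : ℝ} {𝓔 𝓔' : Set (ℝ → ℝ)}
    (h : IsEnergyProfileFamily c₀ T₀ E₁ E₂ 𝓔) (h' : 𝓔' ⊆ 𝓔) : IsEnergyProfileFamily c₀ T₀ E₁ E₂ 𝓔' where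
  contDiff := fun e he => h.contDiff e (h' he)
  lower := fun e he => h.lower e (h' he)
  upper := fun e he => h.upper e (h' he)
  apply_zero_eq := fun e₁ he₁ e₂ he₂ => h.apply_zero_eq e₁ (h' he₁) e₂ (h' he₂)
  deriv_zero_eq := fun e₁ he₁ e₂ he₂ => h.deriv_zero_eq e₁ (h' he₁) e₂ (h' he₂)
  abs_deriv_le := fun e he => h.abs_deriv_le e (h' he)
  abs_iteratedDeriv_two_le := fun e he => h.abs_iteratedDeriv_two_le e (h' he)

/-- Each member of an admissible family is an admissible profile in the sense of
`IsEnergyProfile c₀ T₀ E₁` (De Rosa's hypotheses (i)–(ii): window and slope bound).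
[cite: ColomboDelellisDerosa2018, §2 Prop. 2.2 (i), (iv)] -/
theorem IsEnergyProfileFamily.isEnergyProfile {c₀ T₀ E₁ E₂ : ℝ} {𝓔 : Set (ℝ → ℝ)}
    (h : IsEnergyProfileFamily c₀ T₀ E₁ E₂ 𝓔) {e : ℝ → ℝ} (he : e ∈ 𝓔) :
    IsEnergyProfile c₀ T₀ E₁ e where
  contDiff := h.contDiff e he
  lower := h.lower e he
  upper := h.upper e he
  abs_deriv_le := h.abs_deriv_le e he

/-! ## Colombo–De Lellis–De Rosa 2018, Prop. 2.2 -/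

/-- **Colombo–De Lellis–De Rosa 2018, Prop. 2.2** (prescribed-energy solutions for a family of
profiles, with common datum and an explicit Hölder bound; the output of the convex-integration
scheme of §3, Prop. 3.2, run with universal parameters, §8.3). As printed (§2, p. 5): "Let
`E₁, E₂ > 1`. Assume `𝓔` is a family of smooth functions on `[0,1]` with the property that
(i) `½ ≤ e(t) ≤ 1` for every `t` and every `e ∈ 𝓔`; (ii) `e(0)` is the same for every `e ∈ 𝓔`;
(iii) `e'(0)` is the same for every `e ∈ 𝓔`; (iv) `sup_{e∈𝓔} ‖e‖_{C¹} = E₁`;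
(v) `sup_{e∈𝓔} ‖e‖_{C²} = E₂`. Then for each `e ∈ 𝓔` it is possible to produce a corresponding
pair `(v_e, p_e)` for which the following holds. (a) `(v_e, p_e)` solves (NS); (b) each `v_e`
satisfies `e(t) = ∫_{𝕋³} |v_e|²(x,t) dx ∀ t ∈ [0,1]`; (c) If `α < α + ε < 1/5` and `ε` is
suitably small (depending only upon `α`), then we have the explicit estimate
`‖v_e‖_{C^{α+ε}} ≤ C(α,ε) max{E₁^{2α+3ε}, E₂^{(2α+4ε)/3}}`; (d) The initial data `v_e(·,0)` is
the same for every `e ∈ 𝓔`." Here `(v, p) ∈ C⁰(𝕋³ × [0,1]; ℝ³ × ℝ)` is the pair of Thm. 2.1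
("the argument producing the pair `(v,p)` of Theorem 2.1 gives two additional pieces of
information"), `α ∈ ]0, 1/2[` the dissipation exponent.

Transcription (header: normalisation, and what is not transcribed): for `0 < α < 1/5` there is
`ε₀ > 0` such that for every `0 < ε ≤ ε₀` with `α + ε < 1/5` there are window constants
`c₀, T₀ > 0` and `C > 0` such that for all parameters `1 < E₁ ≤ E₂` and every admissible family
`𝓔` (`IsEnergyProfileFamily c₀ T₀ E₁ E₂ 𝓔`) there is a solution map `v` with, for each `e ∈ 𝓔`:
(a) `v e` is a distributional solution on `𝕋³ × (0,T₀)` (`Torus.IsWeakFracNSSolutionOn T₀ α 1`,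
viscosity `1`) continuous on `[0,T₀] × 𝕋³`; (b) `∫‖v e t x‖² dx = e t` for `t ∈ [0,T₀]`;
(c) `‖v e t‖_∞ + [v e t]_{α+ε} ≤ C max{E₁^{2α+3ε}, E₂^{(2α+4ε)/3}}` for `t ∈ [0,T₀]`; and
(d) `v e₁ 0 = v e₂ 0` for `e₁, e₂ ∈ 𝓔`. Named fact, not proved here (convex integration:
Prop. 3.2 with Lemma 3.1, §§4–8).
[cite: ColomboDelellisDerosa2018, §2 Prop. 2.2; proof §8.3] -/
def ColomboDeLellisDeRosa2018_prop22 : Prop :=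
  ∀ α : ℝ, 0 < α → α < 1 / 5 →
    ∃ ε₀ : ℝ, 0 < ε₀ ∧ ∀ ε : ℝ, 0 < ε → ε ≤ ε₀ → α + ε < 1 / 5 →
      ∃ c₀ T₀ C : ℝ, 0 < c₀ ∧ 0 < T₀ ∧ 0 < C ∧
        ∀ (E₁ E₂ : ℝ) (𝓔 : Set (ℝ → ℝ)), 1 < E₁ → E₁ ≤ E₂ → IsEnergyProfileFamily c₀ T₀ E₁ E₂ 𝓔 →
          ∃ v : (ℝ → ℝ) → ℝ → 𝕋³ → ℝ³,
            (∀ e ∈ 𝓔,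
              Torus.IsWeakFracNSSolutionOn T₀ α 1 (v e) ∧
                ContinuousOn (uncurry (v e)) (Icc 0 T₀ ×ˢ univ) ∧
                (∀ t ∈ Icc 0 T₀, ∫ x, ‖v e t x‖ ^ 2 = e t) ∧
                ∀ t ∈ Icc 0 T₀,
                  FunctionSpaces.eBoundedHolderNorm (Real.toNNReal (α + ε)) (v e t) ≤
                    ENNReal.ofReal (C * max (E₁ ^ (2 * α + 3 * ε)) (E₂ ^ ((2 * α + 4 * ε) / 3)))) ∧
            ∀ e₁ ∈ 𝓔, ∀ e₂ ∈ 𝓔, v e₁ 0 = v e₂ 0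

end NS

end Literature.Analysis.FluidPDE
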